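import Literature.NumberTheory.PAdicHodge.AinfRamifiedWittTwistedTheta
import Literature.NumberTheory.PAdicHodge.LubinTateAinfWittTorsionLiftAction
import Literature.NumberTheory.PAdicHodge.LubinTateCharacterConjugatesTotallyRamified
import HarnessLib

/-!
# `ϑ_{j,ρ}` on the topological ring `A_inf(𝒪_F)` and along Lubin–Tate orbits (general residue degree)

Topic `Literature/NumberTheory/PAdicHodge`. The `W(k_F)`-coefficient version (tree `EisensteinRootW`, `AinfRamWTop`,
`AinfRamW.thetaTwist`) of tree `AinfRamifiedConjugateTheta` §4 and `LubinTateCharacterConjugatesTotallyRamified` §2,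
for the **Frobenius-twisted** conjugate specialisation `ϑ = ϑ_{j,ρ}` (`θ ∘ φ^j` on `𝔸_inf(F)`, `ϖ ↦ ρ`)
— solo-Langlands-informed Stage E2.9b, part 1 (memo `work/s113/E29.md` §3):

* §1 `ϑ` on `AinfRamWTop D` with values in the closed unit ball `CBall F` (`AinfRamWTop.thetaTwist`); values on the
  coefficients `𝒪_D`; `Γ_F`-equivariance for `σ(ρ) = ρ`; ★ `‖ϑ(x) − θ_𝒪(x)^{p^j}‖ ≤ ‖π‖` when `‖ρ‖ ≤ ‖π‖`;
* §2 along the `P`-orbit `x_m = Pᵐ(x)` of a point with `σ x = [a]_P x`: `[a]_P(Pᵐ x) = σ(Pᵐ x)`,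
  `ϑ(Pᵐ x) = P_{ϑ(c)}ᵐ(ϑ x)`, and ★ **`‖P_{ϑ(c)}ᵐ(σ z) − ϑ(a)·P_{ϑ(c)}ᵐ(z)‖ ≤ ‖P_{ϑ(c)}ᵐ(z)‖²`** for `z = ϑ(x)`
  (hypothesis `h` of tree `LangLimit.langLog_eq_mul`).

No named facts, no instances, no `sorry`.

## References
* J.-P. Serre, *Abelian ℓ-adic representations and elliptic curves* (1968), Ch. III §A.5. [SerreAbelianLadic1968]
* J. Lubin, J. Tate, *Formal complex multiplication in local fields*, Ann. of Math. 81 (1965), §1 Thm. 1. [LubinTate1965]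
* S. Lang, *Cyclotomic Fields I and II* (GTM 121, 1990), Ch. 8 §6 Lemma 1–2. [LangCyclotomic1990]
* J.-M. Fontaine, *Le corps des périodes p-adiques*, Astérisque 223 (1994), Exp. II §1.2. [FontaineAsterisque223III]
* J. Tate, *p-divisible groups* (1967), §3.3. [Tate1967]
-/

noncomputable section

open IsLocalRing WittVector

namespace Literature.NumberTheory.PAdicHodge

open Literature.NumberTheory.GaloisRepresentations
open Literature.NumberTheory.GaloisRepresentations.IsNonarchimedeanLocalField
open Literature.NumberTheory.GaloisRepresentations.LubinTate
open Field ValuativeRel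

variable {F : Type} [Field F] [ValuativeRel F] [TopologicalSpace F] [IsNonarchimedeanLocalField F] [CharZero F]
  {p : ℕ} [Fact p.Prime] {hp : valuation F p < 1}

namespace AinfRamWTop

variable [Fact (¬ IsUnit (p : integerC F))] [IsAdicComplete (Ideal.span {(p : integerC F)}) (integerC F)]
  (D : EisensteinRootW F p hp) (j : ℕ) {ρ : integerC F} (hρ : D.poly.eval₂ (twistCoeff hp j) ρ = 0)

/-! ## §1 `ϑ_{j,ρ}` on the topological ring `AinfRamWTop D`, with values in `CBall F` -/

/-- **`ϑ_{j,ρ} : A_inf(𝒪_F) → 𝒪_{ℂ_F}`** on `AinfRamWTop D`, valued in the closed unit ball `CBall F`.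
[cite: SerreAbelianLadic1968, Ch. III §A.5] -/
def thetaTwist : AinfRamWTop D →+* CBall F :=
  (integerCEquivCBall (F := F)).toRingHom.comp ((AinfRamW.thetaTwist D j hρ).comp (of D).symm.toRingHom)

/-- Unfolding `thetaTwist` in `ℂ_F`. [cite: SerreAbelianLadic1968, Ch. III §A.5] -/
theorem coe_thetaTwist (a : AinfRamW D) :
    ((thetaTwist D j hρ (of D a) : CBall F) : CompletedAlgClosure F) = (AinfRamW.thetaTwist D j hρ a : integerC F) := rfl

/-- Unfolding `thetaTwist` on an element of the synonym. [cite: SerreAbelianLadic1968, Ch. III §A.5] -/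
theorem coe_thetaTwist' (a : AinfRamWTop D) :
    ((thetaTwist D j hρ a : CBall F) : CompletedAlgClosure F) =
      (AinfRamW.thetaTwist D j hρ ((of D).symm a) : integerC F) := rfl

/-- `ϑ` takes values of norm `≤ 1`. [cite: SerreAbelianLadic1968, Ch. III §A.5] -/
theorem norm_thetaTwist_le_one (a : AinfRamWTop D) :
    ‖((thetaTwist D j hρ a : CBall F) : CompletedAlgClosure F)‖ ≤ 1 :=
  (LubinTate.mem_unitBall_iff _).1 (thetaTwist D j hρ a).2

set_option maxHeartbeats 400000 in
/-- **`ϑ` on the coefficients `𝒪_D`** is `c_j ⊗ (X ↦ ρ)` (tree `AinfRamW.thetaTwist_coeffHom`).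
[cite: SerreAbelianLadic1968, Ch. III §A.5] -/
theorem coe_thetaTwist_algebraMap_coeffDisc (x : D.Coeff) :
    ((thetaTwist D j hρ (algebraMap (EisensteinRootW.CoeffDisc D) (AinfRamWTop D) (EisensteinRootW.CoeffDisc.of D x)) :
        CBall F) : CompletedAlgClosure F) =
      (AdjoinRoot.lift (twistCoeff hp j) ρ hρ x : integerC F) := by
  rw [EisensteinRootW.algebraMap_coeffDisc_ainfRamTop, coe_thetaTwist, AinfRamW.thetaTwist_coeffHom]

/-- In particular **`ϑ(ϖ_D · 1) = ρ`**. [cite: SerreAbelianLadic1968, Ch. III §A.5] -/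
theorem coe_thetaTwist_algebraMap_varpiDisc :
    ((thetaTwist D j hρ (algebraMap (EisensteinRootW.CoeffDisc D) (AinfRamWTop D)
        (EisensteinRootW.CoeffDisc.of D (AdjoinRoot.root D.poly))) : CBall F) : CompletedAlgClosure F) = ρ := by
  rw [coe_thetaTwist_algebraMap_coeffDisc, AdjoinRoot.lift_root]

/-- **`ϑ ∘ σ = σ ∘ ϑ`** on `AinfRamWTop` for `σ ∈ Γ_F` fixing `ρ`. [cite: FontaineAsterisque223III, Exp. II §1.2] -/
theorem coe_thetaTwist_gal (σ : absoluteGaloisGroup F) (hσ : σ • (ρ : CompletedAlgClosure F) = ρ) (a : AinfRamWTop D) :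
    ((thetaTwist D j hρ (gal D σ a) : CBall F) : CompletedAlgClosure F) =
      σ • ((thetaTwist D j hρ a : CBall F) : CompletedAlgClosure F) :=
  AinfRamW.coe_thetaTwist_gal D j hρ σ hσ ((of D).symm a)

/-- ★ **`‖ϑ(x) − θ_𝒪(x)^{p^j}‖ ≤ ‖π‖`** on `AinfRamWTop` when `‖ρ‖ ≤ ‖π‖` (tree `AinfRamW.norm_coe_thetaTwist_sub_theta_pow_le`).
[cite: SerreAbelianLadic1968, Ch. III §A.5] -/
theorem norm_thetaTwist_sub_theta_pow_le
    (hρπ : ‖(ρ : CompletedAlgClosure F)‖ ≤ ‖((D.unifC : integerC F) : CompletedAlgClosure F)‖) (x : AinfRamWTop D) :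
    ‖((thetaTwist D j hρ x : CBall F) : CompletedAlgClosure F) -
        ((theta D x : CBall F) : CompletedAlgClosure F) ^ p ^ j‖ ≤
      ‖((D.unifC : integerC F) : CompletedAlgClosure F)‖ := by
  have h := AinfRamW.norm_coe_thetaTwist_sub_theta_pow_le D j hρ hρπ ((of D).symm x)
  rw [AddSubgroupClass.coe_sub, SubmonoidClass.coe_pow] at h
  exact h

/-! ## §2 `ϑ` along the `P`-orbit of a point `x` with `σ x = [a]_P x` -/

variable {D} {hθ : Function.Surjective (fontaineTheta (integerC F) p)} {c : EisensteinRootW.CoeffDisc D} {q : ℕ}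
  {hq : q ≠ 0} (hA : IsLTRing c q) (hf : IsLTSeries c q (ltSeries c q))

/-- **`[a]_P(Pᵐ x) = σ(Pᵐ x)` for all `m`, once `σ x = [a]_P x`** (`σ` and `[a]_P` both commute with `P`).
[cite: LubinTate1965, §1 Thm. 1 (9)] [cite: FontaineAsterisque223III, Exp. II §1.2.2] -/
theorem ltSMul_ltStep_iterate_eq_gal (σ : absoluteGaloisGroup F) (a : EisensteinRootW.CoeffDisc D)
    {X : (nilTheta D hθ).toIdeal}
    (hX : gal D σ (X : AinfRamWTop D) = (ltSMul (nilTheta D hθ) hA hf a X : AinfRamWTop D)) (m : ℕ) :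
    (ltSMul (nilTheta D hθ) hA hf a ((ltStep c hq)^[m] X) : AinfRamWTop D) =
      gal D σ (((ltStep c hq)^[m] X : (nilTheta D hθ).toIdeal) : AinfRamWTop D) := by
  induction m with
  | zero => exact hX.symm
  | succ m ih =>
    rw [Function.iterate_succ_apply', gal_ltStep c hq σ, ltSMul_ltStep hA hf a]
    exact congrArg (fun Z : (nilTheta D hθ).toIdeal => ((ltStep c hq Z : (nilTheta D hθ).toIdeal) : AinfRamWTop D))
      (Subtype.ext ih)

variable (D)

/-- **`ϑ(Pᵐ x) = P_{ϑ(c)}ᵐ(ϑ x)`**: under `ϑ` the `P`-iteration in `A_inf(𝒪)` becomes the iteration of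
`z ↦ ϑ(c)·z + z^q` in `ℂ_F`. [cite: LangCyclotomic1990, Ch. 8 §6 Lemma 1] [cite: SerreAbelianLadic1968, Ch. III §A.5] -/
theorem coe_thetaTwist_ltStep_iterate (X : (nilTheta D hθ).toIdeal) (m : ℕ) :
    ((thetaTwist D j hρ (((ltStep c hq)^[m] X : (nilTheta D hθ).toIdeal) : AinfRamWTop D) : CBall F) :
        CompletedAlgClosure F) =
      (LangLimit.ltMap
          ((thetaTwist D j hρ (algebraMap (EisensteinRootW.CoeffDisc D) (AinfRamWTop D) c) : CBall F) :
            CompletedAlgClosure F) q)^[m]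
        ((thetaTwist D j hρ (X : AinfRamWTop D) : CBall F) : CompletedAlgClosure F) := by
  induction m with
  | zero => rfl
  | succ m ih =>
    rw [Function.iterate_succ_apply', Function.iterate_succ_apply', coe_ltStep, map_add, map_mul, map_pow,
      Subring.coe_add, Subring.coe_mul, SubmonoidClass.coe_pow, ih]
    rfl

/-- **`‖σ(ϑ x) − ϑ(a)·ϑ(x)‖ ≤ ‖ϑ x‖²`** when `σ x = [a]_P x` and `σ` fixes `ρ` (`ϑ` is `Γ`-equivariant,
`[a]_P x = a x + x² y`, `‖ϑ y‖ ≤ 1`). [cite: SerreAbelianLadic1968, Ch. III §A.5] [cite: Tate1967, §3.3] -/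
theorem norm_smul_thetaTwist_sub_le (σ : absoluteGaloisGroup F) (hσ : σ • (ρ : CompletedAlgClosure F) = ρ)
    (a : EisensteinRootW.CoeffDisc D) {X : (nilTheta D hθ).toIdeal}
    (hX : gal D σ (X : AinfRamWTop D) = (ltSMul (nilTheta D hθ) hA hf a X : AinfRamWTop D)) :
    ‖σ • ((thetaTwist D j hρ (X : AinfRamWTop D) : CBall F) : CompletedAlgClosure F) -
        ((thetaTwist D j hρ (algebraMap (EisensteinRootW.CoeffDisc D) (AinfRamWTop D) a) : CBall F) :
            CompletedAlgClosure F) *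
          ((thetaTwist D j hρ (X : AinfRamWTop D) : CBall F) : CompletedAlgClosure F)‖ ≤
      ‖((thetaTwist D j hρ (X : AinfRamWTop D) : CBall F) : CompletedAlgClosure F)‖ ^ 2 := by
  obtain ⟨y, hy⟩ := exists_coe_ltSMul_eq_linear (nilTheta D hθ) hA hf a X
  rw [← coe_thetaTwist_gal D j hρ σ hσ, hX, hy, map_add, map_mul, map_mul, map_pow, Subring.coe_add, Subring.coe_mul,
    Subring.coe_mul, SubmonoidClass.coe_pow, add_sub_cancel_left, norm_mul, norm_pow]
  exact mul_le_of_le_one_right (pow_nonneg (norm_nonneg _) 2) (norm_thetaTwist_le_one D j hρ _)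

/-- ★ **The quadratic bound along the whole orbit**: with `z = ϑ(x)`, `κ_c = ϑ(c)`, `κ = ϑ(a)`, `σ x = [a]_P x`, `σ ρ = ρ`:
`‖P_{κ_c}ᵐ(σ z) − κ·P_{κ_c}ᵐ(z)‖ ≤ ‖P_{κ_c}ᵐ(z)‖²` for all `m` (hypothesis `h` of tree `LangLimit.langLog_eq_mul`).
[cite: SerreAbelianLadic1968, Ch. III §A.5] [cite: LangCyclotomic1990, Ch. 8 §6 Lemma 2] -/
theorem norm_ltMap_iterate_smul_thetaTwist_sub_le (σ : absoluteGaloisGroup F) (hσ : σ • (ρ : CompletedAlgClosure F) = ρ)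
    (a : EisensteinRootW.CoeffDisc D) {X : (nilTheta D hθ).toIdeal}
    (hX : gal D σ (X : AinfRamWTop D) = (ltSMul (nilTheta D hθ) hA hf a X : AinfRamWTop D)) (m : ℕ) :
    ‖(LangLimit.ltMap
          ((thetaTwist D j hρ (algebraMap (EisensteinRootW.CoeffDisc D) (AinfRamWTop D) c) : CBall F) :
            CompletedAlgClosure F) q)^[m]
          (σ • ((thetaTwist D j hρ (X : AinfRamWTop D) : CBall F) : CompletedAlgClosure F)) -
        ((thetaTwist D j hρ (algebraMap (EisensteinRootW.CoeffDisc D) (AinfRamWTop D) a) : CBall F) :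
            CompletedAlgClosure F) *
          (LangLimit.ltMap
            ((thetaTwist D j hρ (algebraMap (EisensteinRootW.CoeffDisc D) (AinfRamWTop D) c) : CBall F) :
              CompletedAlgClosure F) q)^[m]
            ((thetaTwist D j hρ (X : AinfRamWTop D) : CBall F) : CompletedAlgClosure F)‖ ≤
      ‖(LangLimit.ltMap
          ((thetaTwist D j hρ (algebraMap (EisensteinRootW.CoeffDisc D) (AinfRamWTop D) c) : CBall F) :
            CompletedAlgClosure F) q)^[m]
          ((thetaTwist D j hρ (X : AinfRamWTop D) : CBall F) : CompletedAlgClosure F)‖ ^ 2 := by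
  have hs : CompletedAlgClosure.galRingHom σ
      ((thetaTwist D j hρ (algebraMap (EisensteinRootW.CoeffDisc D) (AinfRamWTop D) c) : CBall F) :
        CompletedAlgClosure F) =
      ((thetaTwist D j hρ (algebraMap (EisensteinRootW.CoeffDisc D) (AinfRamWTop D) c) : CBall F) :
        CompletedAlgClosure F) := by
    rw [← CompletedAlgClosure.smul_def, ← coe_thetaTwist_gal D j hρ σ hσ, EisensteinRootW.gal_algebraMap_coeffDisc]
  have hq0 : q ≠ 0 := by
    obtain ⟨p', r, hp', hqr, -⟩ := hA.exists_prime
    rw [hqr]; exact pow_ne_zero _ hp'.ne_zero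
  have h1 := norm_smul_thetaTwist_sub_le D j hρ hA hf σ hσ a
    (ltSMul_ltStep_iterate_eq_gal (hq := hq0) hA hf σ a hX m).symm
  rw [coe_thetaTwist_ltStep_iterate D j hρ X m, CompletedAlgClosure.smul_def, LangLimit.map_ltMap_iterate _ hs,
    ← CompletedAlgClosure.smul_def] at h1
  exact h1

end AinfRamWTop

end Literature.NumberTheory.PAdicHodge

end
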